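import Mathlib
import HarnessLib
import Summits.NavierStokesRegularity.NavierStokesRegularity.Theses.LocalOneDirectionTubeDoor
import Summits.NavierStokesRegularity.NavierStokesRegularity.Theorems.LocalSineTubeDoorLocalPointZoomGradSlices

/-!
# Route `LocalOneDirectionTubeDoor` (S13, rung N0-LocalTubeDoorOneDirection) — crux K1 `LocalPointZoomVelGradSlices` is a THEOREM

Cell ns-regularity-ideate, seat p6 (birth filing; the route was opened from the staged package
HOME/ns-regularity-ideate-p6/route-onedirection/).  The crux text is VERBATIM the statement of the tree theorem
`…Theorems.LocalSineTubeDoorLocalPointZoomGradSlices.localPointZoomVelGradSlices` (p441522, the universal first-order zoom of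
the door family); this file records it BY NAME against the born Theses decl (closing item stmt-NavierStokesRegularity-20266).

WHAT THIS IS NOT: not a claim about Navier–Stokes regularity (Clay A).  The leaf is a regularity CRITERION (local Type I
+ L¹-fading of the scale-normalised directional derivative (T−t)·∂ₑu, for every fixed e ≠ 0, on ONE similarity window ⇒
backward bounded), one rung of LADDER-NS N0 (N0-LocalTubeDoorOneDirection); establishment in the cell's sense still
requires the cross-family referee PASS + independent reproduction.
-/

noncomputable section

-- the summit and its single sub-problem share the name (CONVENTIONS §1), as in every Theorems file
set_option linter.dupNamespace false

namespace Summit.NavierStokesRegularity.NavierStokesRegularity.Theorems.LocalOneDirectionTubeDoorLocalPointZoomVelGradSlicesClose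

open Summit.NavierStokesRegularity.NavierStokesRegularity.Theorems.LocalSineTubeDoorLocalPointZoomGradSlices

/-- **Crux K1 `LocalPointZoomVelGradSlices` (item stmt-NavierStokesRegularity-20266) is a THEOREM**: the born decl unfolds to the
statement of `localPointZoomVelGradSlices` (p441522). -/
theorem localPointZoomVelGradSlices_proof :
    Summit.NavierStokesRegularity.NavierStokesRegularity.Theses.LocalOneDirectionTubeDoor.LocalPointZoomVelGradSlices := by
  unfold Summit.NavierStokesRegularity.NavierStokesRegularity.Theses.LocalOneDirectionTubeDoor.LocalPointZoomVelGradSlices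
  exact localPointZoomVelGradSlices

end Summit.NavierStokesRegularity.NavierStokesRegularity.Theorems.LocalOneDirectionTubeDoorLocalPointZoomVelGradSlicesClose

end
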